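import Summits.ResolutionOfSingularities.ResolutionOfSingularities.Theorems.PurelyInseparableDim4ResConeTSectorLossyHeavyLetter
import HarnessLib
import HarnessLib.Audit.Tags

/-!
# Purely inseparable four-folds — T-SECTOR LOSSY TAILS, SHARPER REGIME `3d ≤ p + 1`: still ONE heavy permanent letter
# (cell `res-dim4-pi`, K2(p) lane, B-LOSSY rows in the T-sector; seat res-dim4-p-8 g7)

[OURS · counted 0 · cell `res-dim4-pi` · K2(p) lane (holder res-dim4-p-12 g5, rulings g5-28: «B-LOSSY frame of record for D's regime») · seat
res-dim4-p-8 g7.]  **HONEST LABEL.**  A p-GENERIC, d-GENERIC LEDGER THEOREM about OUR frame (weights only, no certificate, no `decide`); it confines,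
it kills nothing.  Nothing here proves any TAIL(p, d, ·), K2(7), K2(p), `NoIsolatedTrap p p`, CJS 6.40 or resolution of singularities in dimension
≥ 4 / characteristic `p` — NOT proved.  AI kernel work, weaker than expert review.

THE THEOREM **`tsector_lossy_heavy_letter_sharp`**: the conclusion of `tsector_lossy_heavy_letter` (`…TSectorLossyHeavyLetter`, regime `4d ≤ p + 3`)
— one letter `z ≠ φ` never charted nor translated at late times, of constant weight `m` with `p + 2 ≤ m + 2d`, `m + d + 1 ≤ p`, every other letter
weighing `≤ d − 1` — holds already in the regime **`3d ≤ p + 1`** (e.g. `(11, 4)`, `(17, 6)`, `(23, 8)` are now covered; g6's `blf.py` confirms the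
two-active-letter shape at `(11, 4)`).  NEW INGREDIENT (replacing «the fourth letter weighs > d − 1»): a MAX-WEIGHT DESCENT — if all three
non-carrier letters were charted beyond every index, then once they all weigh `≤ B` (`B ≤ d − 1`) every newborn weighs `≤ 3B + d − p ≤ B − 1`
(`3d ≤ p + 1`), so after each full round of charts the common bound drops by one, and after `d − 1` rounds the total weight falls below the floor
`p + 1 − d` — contradiction (`round_descent`, `no_three_charted`).  Hence some non-carrier letter `z` is eventually never charted; it is never
lost either (two light letters cannot carry the floor: `2(d − 1) < p + 1 − d`), so it is permanent, and the heavy / lossy bounds of D finish.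
[cite: CossartJannsenSaito2020, Thm. 3.14] [cite: HauserPerlega2019PRIMS, §2] bears_on: LADDER-RESOLUTION:D157-DOOR2 (res-dim4-pi · K2(p) B-LOSSY ·
T-sector lossy tails, heavy permanent letter, regime 3d ≤ p + 1).  Supports stmt-ResolutionOfSingularities-16155 (helper).
-/

set_option linter.dupNamespace false -- mandated namespace of this single-conjunct summit

noncomputable section

namespace Summit.ResolutionOfSingularities.ResolutionOfSingularities.Theorems.PIDim4

namespace ResCone

open MvPolynomial Finset Literature.AlgebraicGeometry.Resolution
open Literature.AlgebraicGeometry.Resolution.CentreBlowup Literature.AlgebraicGeometry.Resolution.Hauser2010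
open WeightLedger

namespace WeightLedger

/-- The two letters other than two given distinct ones; the four exhaust `Fin 4`. [folklore] -/
theorem exists_two_others {z φ : Fin 4} (hzφ : z ≠ φ) :
    ∃ x y : Fin 4, x ≠ y ∧ x ≠ z ∧ x ≠ φ ∧ y ≠ z ∧ y ≠ φ ∧ ∀ i : Fin 4, i = x ∨ i = y ∨ i = z ∨ i = φ := by
  revert z φ
  decide

end WeightLedger

section Chain

variable {K : Type} [Field K] (p : ℕ) [Fact p.Prime] [CharP K p] [DecidableEq K]
  {c : ℕ → State K} {j : ℕ → Fin 4} {b : ℕ → Fin 4 → K}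

/-- **T-SECTOR LOSSY TAILS, `3d ≤ p + 1`: ONE HEAVY PERMANENT LETTER** (every prime, every shade in the regime, any `e_G`): a letter `z ≠ φ`
never charted nor translated at late times, of constant weight `m` with `p + 2 ≤ m + 2d` and `m + d + 1 ≤ p`, all other letters weighing `≤ d − 1`.
[OURS] [cite: CossartJannsenSaito2020, Thm. 3.14] -/
theorem tsector_lossy_heavy_letter_sharp {d : ℕ} (hpd : 3 * d ≤ p + 1)
    (hc : ∀ k, IsIsolated p (c k).F ∧ Step0 p (c k) (c (k + 1))) (hw : FreeTail.IsWitnessedChain p c j b)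
    (hr0 : ∀ e ∈ (c 0).F.support, (c 0).r ≤ e) (hfloor : ∀ k, ordZero (c k).F ≠ p) {k₀ : ℕ}
    (hshade : ∀ k, k₀ ≤ k → (c k).shade = (d : ℕ∞)) (hlossy : ∀ k₂, ∃ k, k₂ ≤ k ∧ Lossy ⇑(c k).r ⇑(c (k + 1)).r)
    {φ : Fin 4} (hφ : ∀ k, k₀ ≤ k → (c k).r φ = 0 ∧ j k ≠ φ) :
    ∃ (z : Fin 4) (k₂ : ℕ), k₀ ≤ k₂ ∧ z ≠ φ ∧
      p + 2 ≤ (c k₂).r z + 2 * d ∧ (c k₂).r z + d + 1 ≤ p ∧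
      (∀ k, k₂ ≤ k → (c k).r z = (c k₂).r z ∧ j k ≠ z ∧ b k z = 0) ∧
      (∀ k, k₂ ≤ k → ∀ i, i ≠ z → (c k).r i + 1 ≤ d) := by
  classical
  have hleg : ∀ k, k₀ ≤ k → Legal p d ⇑(c k).r := fun k hk => tail_ledger_legal p hc hw hr0 hfloor hshade hk
  have hchild : ∀ k, k₀ ≤ k → ⇑(c (k + 1)).r = child p d ⇑(c k).r (j k) (fun i => decide (b k i = 0)) :=
    fun k hk => tail_ledger_child p hc hw hr0 hfloor hshade hk
  have hnew : ∀ k, k₀ ≤ k → (c (k + 1)).r (j k) = wsum ⇑(c k).r + d - p := fun k hk => by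
    have h1 := congrFun (hchild k hk) (j k); rwa [child_apply_self] at h1
  have hoff : ∀ k, k₀ ≤ k → ∀ i, i ≠ j k → (c (k + 1)).r i = (if b k i = 0 then (c k).r i else 0) :=
    fun k hk i hi => by have h1 := congrFun (hchild k hk) i; rwa [child_apply_of_ne_decide _ hi] at h1
  have hoff_le : ∀ k, k₀ ≤ k → ∀ i, i ≠ j k → (c (k + 1)).r i ≤ (c k).r i := fun k hk i hi => by
    rw [hoff k hk i hi]; split_ifs <;> omega
  -- the band `p + 1 − d ≤ |r| ≤ p − 1`
  obtain ⟨u, v, w, huv, huw, hvw, huφ, hvφ, hwφ⟩ := WeightLedger.exists_three_others φ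
  have hsum3 : ∀ a : Fin 4 → ℕ, wsum a = a u + a v + a w + a φ :=
    fun a => WeightLedger.wsum_eq_four a huv huw huφ hvw hvφ hwφ
  have hband : ∀ k, k₀ ≤ k → p + 1 ≤ wsum ⇑(c k).r + d ∧ wsum ⇑(c k).r + 1 ≤ p := by
    intro k hk
    obtain ⟨hfl, -, -, htri⟩ := hleg k hk
    have h3 := htri u v w huv huw hvw
    have hs := hsum3 ⇑(c k).r
    have hφ0 : (⇑(c k).r) φ = 0 := (hφ k hk).1
    constructor <;> omega
  have hnew_le : ∀ k, k₀ ≤ k → 1 ≤ (c (k + 1)).r (j k) ∧ (c (k + 1)).r (j k) + 1 ≤ d := fun k hk => by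
    have h1 := hnew k hk; have h2 := hband k hk; omega
  -- a bound `B` with `2B + d + 1 ≤ p` on a letter persists (newborns stay `≤ B` while all three letters are `≤ B` — we use the
  -- weaker per-letter form: a charted letter gets `≤ d − 1`, a kept letter keeps, a lost letter gets `0`)
  have persist : ∀ k, k₀ ≤ k → ∀ i, (c k).r i + 1 ≤ d → ∀ n, (c (k + n)).r i + 1 ≤ d := by
    intro k hk i hi n
    induction n with
    | zero => simpa using hi
    | succ n ih =>
      rw [← Nat.add_assoc]
      by_cases hij : i = j (k + n)
      · rw [hij]; exact (hnew_le (k + n) (by omega)).2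
      · have := hoff_le (k + n) (by omega) i hij; omega
  -- MAX-WEIGHT DESCENT: the three non-carrier letters are not all charted beyond every index
  have no_three : ¬ (∀ i : Fin 4, i ≠ φ → ∀ T, ∃ k, T ≤ k ∧ j k = i) := by
    intro H
    -- common bound `B` on `u, v, w` from a time `s ≥ k₀` drops by one after a full round
    have round : ∀ B s, k₀ ≤ s → (∀ k, s ≤ k → (c k).r u ≤ B ∧ (c k).r v ≤ B ∧ (c k).r w ≤ B) → 1 ≤ B →
        ∃ s', s ≤ s' ∧ ∀ k, s' ≤ k → (c k).r u ≤ B - 1 ∧ (c k).r v ≤ B - 1 ∧ (c k).r w ≤ B - 1 := by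
      intro B s hs hB hB1
      -- newborns after `s` weigh `≤ B − 1`
      have hnb : ∀ k, s ≤ k → (c (k + 1)).r (j k) ≤ B - 1 := by
        intro k hk
        have h1 := hnew k (by omega); have h2 := hband k (by omega); have h3 := hB k hk; have h4 := hsum3 ⇑(c k).r
        have hφ0 : (⇑(c k).r) φ = 0 := (hφ k (by omega)).1
        omega
      -- after being charted at `t ≥ s`, a letter stays `≤ B − 1`
      have after : ∀ i t, s ≤ t → j t = i → ∀ n, (c (t + 1 + n)).r i ≤ B - 1 := by
        intro i t ht hjt n
        induction n with
        | zero => simpa [← hjt] using hnb t ht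
        | succ n ih =>
          rw [← Nat.add_assoc]
          by_cases hij : i = j (t + 1 + n)
          · rw [hij]; exact hnb (t + 1 + n) (by omega)
          · exact le_trans (hoff_le (t + 1 + n) (by omega) i hij) ih
      obtain ⟨tu, htu, hju⟩ := H u huφ s
      obtain ⟨tv, htv, hjv⟩ := H v hvφ s
      obtain ⟨tw, htw, hjw⟩ := H w hwφ s
      refine ⟨tu + tv + tw + 1, by omega, fun k hk => ⟨?_, ?_, ?_⟩⟩
      · obtain ⟨n, rfl⟩ := Nat.exists_eq_add_of_le (show tu + 1 ≤ k by omega); exact after u tu htu hju n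
      · obtain ⟨n, rfl⟩ := Nat.exists_eq_add_of_le (show tv + 1 ≤ k by omega); exact after v tv htv hjv n
      · obtain ⟨n, rfl⟩ := Nat.exists_eq_add_of_le (show tw + 1 ≤ k by omega); exact after w tw htw hjw n
    -- initial bound `d − 1` after every letter has been charted once
    have start : ∃ s, k₀ ≤ s ∧ ∀ k, s ≤ k → (c k).r u ≤ d - 1 ∧ (c k).r v ≤ d - 1 ∧ (c k).r w ≤ d - 1 := by
      have after0 : ∀ i t, k₀ ≤ t → j t = i → ∀ n, (c (t + 1 + n)).r i + 1 ≤ d := by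
        intro i t ht hjt n
        have h0 : (c (t + 1)).r i + 1 ≤ d := by rw [← hjt]; exact (hnew_le t ht).2
        exact persist (t + 1) (by omega) i h0 n
      obtain ⟨tu, htu, hju⟩ := H u huφ k₀
      obtain ⟨tv, htv, hjv⟩ := H v hvφ k₀
      obtain ⟨tw, htw, hjw⟩ := H w hwφ k₀
      refine ⟨tu + tv + tw + 1, by omega, fun k hk => ⟨?_, ?_, ?_⟩⟩
      · obtain ⟨n, rfl⟩ := Nat.exists_eq_add_of_le (show tu + 1 ≤ k by omega); have := after0 u tu htu hju n; omega
      · obtain ⟨n, rfl⟩ := Nat.exists_eq_add_of_le (show tv + 1 ≤ k by omega); have := after0 v tv htv hjv n; omega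
      · obtain ⟨n, rfl⟩ := Nat.exists_eq_add_of_le (show tw + 1 ≤ k by omega); have := after0 w tw htw hjw n; omega
    -- descend `d − 1` times
    have descend : ∀ n, n ≤ d - 1 → ∃ s, k₀ ≤ s ∧ ∀ k, s ≤ k →
        (c k).r u ≤ d - 1 - n ∧ (c k).r v ≤ d - 1 - n ∧ (c k).r w ≤ d - 1 - n := by
      intro n
      induction n with
      | zero => intro _; simpa using start
      | succ n ih =>
        intro hn
        obtain ⟨s, hs, hB⟩ := ih (by omega)
        obtain ⟨s', hss', hB'⟩ := round (d - 1 - n) s hs hB (by omega)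
        refine ⟨s', by omega, fun k hk => ?_⟩
        have := hB' k hk
        rw [show d - 1 - (n + 1) = d - 1 - n - 1 by omega]
        exact this
    obtain ⟨s, hs, hB⟩ := descend (d - 1) le_rfl
    have h1 := hB s le_rfl
    have h2 := hband s hs
    have h3 := hsum3 ⇑(c s).r
    have hφ0 : (⇑(c s).r) φ = 0 := (hφ s hs).1
    omega
  -- hence a non-carrier letter `z` is eventually never charted
  push Not at no_three
  obtain ⟨z, hzφ, T, hT⟩ := no_three
  -- the two other letters are charted (FT), hence light from some time on
  obtain ⟨x, y, hxy, hxz, hxφ, hyz, hyφ, hexh⟩ := WeightLedger.exists_two_others hzφ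
  have hsum4 : ∀ a : Fin 4 → ℕ, wsum a = a x + a y + a z + a φ :=
    fun a => WeightLedger.wsum_eq_four a hxy hxz hxφ (Ne.symm hyz |>.symm) hyφ hzφ
  obtain ⟨k₁, hk₁, hsat⟩ := exists_satellite_after p hc hw (max k₀ T)
  have hk₁0 : k₀ ≤ k₁ := le_trans (le_max_left _ _) hk₁
  have hk₁T : T ≤ k₁ := le_trans (le_max_right _ _) hk₁
  -- the satellite's two charts are `x` and `y` in some order
  have hcharts : ∀ i, (i = j k₁ ∨ i = j (k₁ + 1)) → i = x ∨ i = y := by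
    intro i hi
    rcases hexh i with h | h | h | h
    · exact Or.inl h
    · exact Or.inr h
    · exfalso; rcases hi with rfl | rfl
      · exact absurd h (fun h' => hT k₁ hk₁T h')
      · exact absurd h (fun h' => hT (k₁ + 1) (by omega) h')
    · exfalso; rcases hi with rfl | rfl
      · exact (hφ k₁ hk₁0).2 h
      · exact (hφ (k₁ + 1) (by omega)).2 h
  set K := k₁ + 2 with hK
  have hlightK : ∀ k, K ≤ k → (c k).r x + 1 ≤ d ∧ (c k).r y + 1 ≤ d := by
    -- both `x` and `y` are among the two charts `j k₁ ≠ j (k₁+1)`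
    have hj0 := hcharts (j k₁) (Or.inl rfl)
    have hj1 := hcharts (j (k₁ + 1)) (Or.inr rfl)
    have hne : j (k₁ + 1) ≠ j k₁ := hsat.1
    have lightAfter : ∀ t, k₀ ≤ t → ∀ k, t + 1 ≤ k → (c k).r (j t) + 1 ≤ d := by
      intro t ht k hk
      obtain ⟨n, rfl⟩ := Nat.exists_eq_add_of_le hk
      exact persist (t + 1) (by omega) (j t) (hnew_le t ht).2 n
    intro k hk
    constructor
    · rcases hj0 with h0 | h0
      · rw [← h0]; exact lightAfter k₁ hk₁0 k (by omega)
      · rcases hj1 with h1 | h1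
        · rw [← h1]; exact lightAfter (k₁ + 1) (by omega) k (by omega)
        · exact absurd (h1.trans h0.symm) hne
    · rcases hj0 with h0 | h0
      · rcases hj1 with h1 | h1
        · exact absurd (h1.trans h0.symm) hne
        · rw [← h1]; exact lightAfter (k₁ + 1) (by omega) k (by omega)
      · rw [← h0]; exact lightAfter k₁ hk₁0 k (by omega)
  -- `z` keeps weight `≥ 1`, hence is never lost: permanent with constant weight
  have hz1 : ∀ k, K ≤ k → 1 ≤ (c k).r z := fun k hk => by
    have h1 := hband k (by omega); have h2 := hsum4 ⇑(c k).r; have h3 := hlightK k hk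
    have hφ0 : (⇑(c k).r) φ = 0 := (hφ k (by omega)).1
    omega
  have hjz : ∀ k, K ≤ k → j k ≠ z := fun k hk => hT k (by omega)
  have hbz : ∀ k, K ≤ k → b k z = 0 := fun k hk => by
    by_contra hne
    have h1 := hoff k (by omega) z (Ne.symm (hjz k hk)); rw [if_neg hne] at h1
    have h2 := hz1 (k + 1) (by omega); omega
  have hzconst : ∀ k, K ≤ k → (c k).r z = (c K).r z := by
    intro k hk
    obtain ⟨n, rfl⟩ := Nat.exists_eq_add_of_le hk
    induction n with
    | zero => rfl
    | succ n ih =>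
      rw [← ih (by omega), ← Nat.add_assoc]
      have h1 := hoff (K + n) (by omega) z (Ne.symm (hjz (K + n) (by omega)))
      rwa [if_pos (hbz (K + n) (by omega))] at h1
  set m := (c K).r z with hm
  -- heavy bound (res-dim4-p-5)
  have hmU : m + d + 1 ≤ p := by
    by_contra hlt
    refine no_tail_of_permanent_weight_ge p hc hw hr0 hfloor hshade (M := K) (by omega) (P := {z}) ?_ ?_
    · intro z' hz' m' hm'
      rw [Finset.mem_singleton] at hz'; subst hz'
      exact ⟨Ne.symm (hjz m' hm'), hbz m' hm'⟩
    · rw [Finset.sum_singleton]; omega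
  -- lossy bound
  have hloss : ∀ k, K ≤ k → Lossy ⇑(c k).r ⇑(c (k + 1)).r →
      wsum ⇑(c (k + 1)).r = wsum ⇑(c k).r + d - p + m := by
    intro k hk ⟨i, hi1, hi0⟩
    have hkk : k₀ ≤ k := by omega
    have hφ0 : (⇑(c k).r) φ = 0 := (hφ k hkk).1
    have hφ0' : (⇑(c (k + 1)).r) φ = 0 := (hφ (k + 1) (by omega)).1
    have hzk1 : (c (k + 1)).r z = m := hzconst (k + 1) (by omega)
    have hzk : (c k).r z = m := hzconst k hk
    have hij : i ≠ j k := fun h => by have := (hnew_le k hkk).1; rw [← h] at this; omega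
    have hiz : i ≠ z := fun h => by rw [h] at hi0; have := hz1 (k + 1) (by omega); omega
    have hiφ : i ≠ φ := fun h => by rw [h] at hi1; omega
    have hs0 := hsum4 ⇑(c k).r
    have hs1 := hsum4 ⇑(c (k + 1)).r
    have hnk := hnew k hkk
    rcases hexh (j k) with hj | hj | hj | hj
    · rcases hexh i with rfl | rfl | rfl | rfl
      · exact absurd hj.symm hij
      · rw [hj] at hnk; omega
      · exact absurd rfl hiz
      · exact absurd rfl hiφ
    · rcases hexh i with rfl | rfl | rfl | rfl
      · rw [hj] at hnk; omega
      · exact absurd hj.symm hij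
      · exact absurd rfl hiz
      · exact absurd rfl hiφ
    · exact absurd hj (hjz k hk)
    · exact absurd hj (hφ k hkk).2
  have hmL : p + 2 ≤ m + 2 * d := by
    obtain ⟨k, hk, hl⟩ := hlossy K
    have h1 := hloss k hk hl
    have h2 := hband k (by omega); have h3 := hband (k + 1) (by omega)
    omega
  refine ⟨z, K, by omega, hzφ, hmL, hmU, fun k hk => ⟨hzconst k hk, hjz k hk, hbz k hk⟩, fun k hk i hi => ?_⟩
  rcases hexh i with rfl | rfl | rfl | rfl
  · exact (hlightK k hk).1
  · exact (hlightK k hk).2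
  · exact absurd rfl hi
  · have hφ0 : (⇑(c k).r) i = 0 := (hφ k (by omega)).1
    have := (hnew_le k (by omega)).2
    omega

end Chain

end ResCone

end Summit.ResolutionOfSingularities.ResolutionOfSingularities.Theorems.PIDim4

end
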